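import Summits.ResolutionOfSingularities.ResolutionOfSingularities.Theorems.SplitCutCells
import Summits.ResolutionOfSingularities.ResolutionOfSingularities.Theorems.MaxContactCutPurityCut
import HarnessLib

/-!
# MaxContactCutSplitCut — the decomp-res node «SplitCut» BY NAME on the host route `MaxContactCut` (lens-2 g17, pin 301f7a3a)

Content VERBATIM from the decomp-res lens-2 g17 node `HOME/decomp-res-lens-2/g17/SplitCut.lean` (pin 301f7a3a, 2 469
l; parts in `g17/parts/`, SHA256SUMS verified by the critic;
HOME = run/shared/lean/pub/decomp-res; CRITIC-LEDGER row 146 (claim DECIDED-MOD-PORT(M+) +1 under row 140's window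
(ii)); landing orders INBOX :365: land AFTER the PurityCut
chain with ALL restated sections (§R16, §R, §G, §P, §H — l. 244–2018: the lens's verbatim-in-body copies of lens-2
g14 `PinchCut`, g15 `JetCut` rev 5 and g16 `PurityCut` rev 1)
DELETED and the landed modules imported instead (namespaces `…Theorems.PinchCut`, `…Theorems.JetCut` (+ `Vast`),
`…Theorems.PurityCut` (+ `Leaf`, `Grand`) opened; same short
names, byte-identical bodies — never two copies).  Namespace `…Theorems.SplitCut` (the lens's `Theses.SplitCut` is
gate-reserved), sub-namespace `Split` as in the lens;
file split only (tree files ≤ 400 lines): sections, variables and every declaration exactly as in the lens; the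
node's global dupNamespace-linter line dropped.  Node files,
in import order: `SplitCutKernels` (§S1) · `SplitCutClasses` (§S2 + the cone-free head of §T) · `SplitCutCells`
(§T2–§T4 cone-free: the aside home) · the wiring
`MaxContactCutSplitCut` (§T BY NAME on the host route, in the Theses cone).  All `--supports
stmt-ResolutionOfSingularities-29273` (`MaxContactCut.RungOne`); nothing closes
29273 — decided halves carry their engines as hypotheses; exactly ONE located-residual aside on the lens-2 column
(`Split.SplitSpecialRung`, home `SplitCutCells`) SUPERSEDES
g16's `Grand.GrandSpecialRung`, re-located EXACTLY modulo the split decided half (`grandSpecialRung_iff_splitSpecialRung`).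

THE WIRING of the node VERBATIM, BY NAME on the host route `MaxContactCut` (in the Theses cone), in lens order:
`Split.rungOne_iff : MaxContactCut.RungOne ⟺ SplitGenericRung ∧ SplitSpecialRung`, **`Split.closes`** (29273 BY NAME
from the two split halves), `closes_of_engines`, **`grandSpecialRung_iff_splitSpecialRung`** (g16's residual ⟺ the
split residual modulo the decided half), the vast / leaf / pinch re-locations (tree aside 33866
`MaxContactCut.LeafSpecialRung`), `grand_closes_of_split` — 0 sorry.  Imports the aside home `SplitCutCells` and
`MaxContactCutPurityCut`.  Supports 29273.

This file carries: `Split.rungOne_iff`, `Split.splitGenericRung_of_rungOne`, `Split.splitSpecialRung_of_rungOne`,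
`Split.splitSpecialRung_iff_rungOne`, `Split.closes`, `Split.closes_of_engines`,
`Split.grandSpecialRung_iff_splitSpecialRung`, `Split.vastSpecialRung_iff_splitSpecialRung`,
`Split.leafSpecialRung_iff_splitSpecialRung`, `Split.leafGenericRung_of_splitGenericRung`,
`Split.pinchSpecialRung_iff_splitSpecialRung`, `Split.closes_of_grandSpecialRung`, `Split.grand_closes_of_split`.

(Sources: Hironaka1964 Ch. III; CossartJannsenSaito2020 Ch. 2, Ch. 8–9; CossartPiltant2008 Prop. 4.2;
CossartPiltant2019 Rem. 3.2; BierstoneGrigorievMilmanWlodarczyk2011 §3.1; Moh1987; Hauser2010Kangaroo; Giraud1975;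
Narasimhan1983.)
-/

open CategoryTheory AlgebraicGeometry TopologicalSpace IsLocalRing
open Literature.AlgebraicGeometry.Resolution
open Summit.ResolutionOfSingularities.ResolutionOfSingularities.Theorems
open Summit.ResolutionOfSingularities.ResolutionOfSingularities.Theorems.WeakOrderReduction
open Summit.ResolutionOfSingularities.ResolutionOfSingularities.Theorems.DeltaFaceCutClasses
open Summit.ResolutionOfSingularities.ResolutionOfSingularities.Theorems.RelativeDeltaCut
open Summit.ResolutionOfSingularities.ResolutionOfSingularities.Theorems.CurveLeafExit
open Summit.ResolutionOfSingularities.ResolutionOfSingularities.Theorems.PinchCut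
open Summit.ResolutionOfSingularities.ResolutionOfSingularities.Theorems.JetCut
open Summit.ResolutionOfSingularities.ResolutionOfSingularities.Theorems.PurityCut
open Summit.ResolutionOfSingularities.ResolutionOfSingularities.Theses

namespace Summit.ResolutionOfSingularities.ResolutionOfSingularities.Theorems.SplitCut

namespace Split

section Kernels

variable {n : ℕ}

/-- **EXACT AT THE RUNG**: `RungOne ⟺ SplitGenericRung ∧ SplitSpecialRung`. [folklore] -/
theorem rungOne_iff : MaxContactCut.RungOne ↔ SplitGenericRung ∧ SplitSpecialRung :=
  Leaf.rungOne_iff (L := splitLeaf)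

/-- NECESSITY by letter. [folklore] -/
theorem splitGenericRung_of_rungOne (h : MaxContactCut.RungOne) : SplitGenericRung := (rungOne_iff.mp h).1

/-- NECESSITY by letter. [folklore] -/
theorem splitSpecialRung_of_rungOne (h : MaxContactCut.RungOne) : SplitSpecialRung := (rungOne_iff.mp h).2

/-- HONESTY KERNEL: modulo the decided half, the located residual IS the rung (cofinal). [folklore] -/
theorem splitSpecialRung_iff_rungOne (hG : SplitGenericRung) : SplitSpecialRung ↔ MaxContactCut.RungOne :=
  Leaf.specialRung_iff_rungOne (L := splitLeaf) hG

/-- **DECIDING IMPLICATION OF THE NODE**: `MaxContactCut.RungOne` (29273) BY NAME from the two halves. [folklore] -/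
theorem closes (hG : SplitGenericRung) (hS : SplitSpecialRung) : MaxContactCut.RungOne :=
  Leaf.closes (L := splitLeaf) hG hS

/-- `RungOne` BY NAME from the engines, the ports and the located residual. [folklore] -/
theorem closes_of_engines (hV : VeryNearCutClasses.VeryNearExit) (hD : DeltaPackageExit)
    (hU : UniformCurvePackageExit) (hR : RelCurvePackageExit) (hN : NormalConeJumpExit)
    (hM : MonomialPinchExit) (hC : FlatConeExit) (hGE : GrandExit) (hSE : SplitConeExit)
    (hP : ∀ n : ℕ, 2 ≤ n → CurvePackagePort n) (h1 : FaceFormCutClasses.OrderOneContact)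
    (hS : SplitSpecialRung) : MaxContactCut.RungOne :=
  closes (splitGenericRung_of_engines hV hD hU hR hN hM hC hGE hSE hP h1) hS

/-- **EXACT RE-LOCATION OF g16's `Grand.GrandSpecialRung`** (the located residual the instruction names): modulo the
split decided
half, `Grand.GrandSpecialRung ⟺ SplitSpecialRung`. [folklore] -/
theorem grandSpecialRung_iff_splitSpecialRung (hG : SplitGenericRung) : Grand.GrandSpecialRung ↔ SplitSpecialRung :=
  Grand.grandSpecialRung_iff.trans (Leaf.specialRung_iff_of_le grandLeaf_le_splitLeaf hG)

/-- **EXACT RE-LOCATION OF g15's `Vast.VastSpecialRung`**: modulo the split decided half, `Vast.VastSpecialRung ⟺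
SplitSpecialRung`.
[folklore] -/
theorem vastSpecialRung_iff_splitSpecialRung (hG : SplitGenericRung) : Vast.VastSpecialRung ↔ SplitSpecialRung :=
  vastSpecialRung_iff.trans (Leaf.specialRung_iff_of_le vastLeaf_le_splitLeaf hG)

/-- **EXACT RE-LOCATION OF THE TREE ASIDE 33866** `MaxContactCut.LeafSpecialRung` BY NAME: modulo the split decided half,
`LeafSpecialRung ⟺ SplitSpecialRung`. [folklore] -/
theorem leafSpecialRung_iff_splitSpecialRung (hG : SplitGenericRung) : MaxContactCut.LeafSpecialRung ↔ SplitSpecialRung :=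
  Leaf.leafSpecialRung_iff_specialRung (L := splitLeaf) hG

/-- The tree aside 33865 `MaxContactCut.LeafGenericRung` BY NAME from the split decided half. [folklore] -/
theorem leafGenericRung_of_splitGenericRung (hG : SplitGenericRung) : MaxContactCut.LeafGenericRung :=
  Leaf.leafGenericRung_of_genericRung (L := splitLeaf) hG

/-- **EXACT RE-LOCATION OF g14's `PinchSpecialRung`**: modulo the split decided half, `PinchSpecialRung ⟺ SplitSpecialRung`.
[folklore] -/
theorem pinchSpecialRung_iff_splitSpecialRung (hG : SplitGenericRung) : PinchSpecialRung ↔ SplitSpecialRung :=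
  pinchSpecialRung_iff.trans (Leaf.specialRung_iff_of_le pinchLeaf_le_splitLeaf hG)

/-- `RungOne` BY NAME from the split decided half and g16's residual (the old residual still closes). [folklore] -/
theorem closes_of_grandSpecialRung (hG : SplitGenericRung) (hS : Grand.GrandSpecialRung) : MaxContactCut.RungOne :=
  closes hG (splitSpecialRung_of_grandSpecialRung hS)

/-- The g16 node's `closes` is RECOVERED from the split halves plus engine-free monotonicity (nothing of g16 is
lost). [folklore] -/
theorem grand_closes_of_split (hG : SplitGenericRung) (hS : SplitSpecialRung) : MaxContactCut.RungOne :=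
  Grand.closes (grandGenericRung_of_splitGenericRung hG) ((grandSpecialRung_iff_splitSpecialRung hG).mpr hS)

end Kernels

end Split

end Summit.ResolutionOfSingularities.ResolutionOfSingularities.Theorems.SplitCut
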